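import Summits.ValiantsHypothesis.ValiantsHypothesis.Theorems.KPlusLogSqLawTridiagonalRealStaticUnitRecessiveCountSharp

/-!
# Route «KPlusLogSqLaw», crux `WeakLifting` (stmt-ValiantsHypothesis-19561) — REAL side of the tridiagonal sector:
# the UNIT-COEFFICIENT sub-sector — the recessive count law for ALL SIZES under the WEAK separation hypothesis (non-degeneracy removed)

HONEST FRAMING.  Helper theorems (`--supports stmt-ValiantsHypothesis-19561 --as helper`), seat val-sym-lift-p1 (g19), cell `pub-symmetroid`,
2026-08-28; the all-sizes companion of `…UnitRecessiveCountSharp` (p641687), replacing g18's `card_roots_unit_interval_eq_div_three_of_sep`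
(p638539: non-degenerate zeros + strong separation).  Continuants `D_k = pathDet (fun _ => 1) d (fun _ => 1) f k`, all slopes positive, Sturm count
`V(x) = #{k < m : D_k(x)D_{k+1}(x) < 0}`.  WEAK SEPARATION at a zero `t`: no two NEGATIVE pivot products three edges apart
(`¬(D_kD_{k+1}(t) < 0 ∧ D_{k+3}D_{k+4}(t) < 0)`, «no N J A N»); degenerate zeros allowed (`…UnitSplitting.slopeEnergy_pos_below_one_of_weakSep`).
Proved here (all sizes `m ≥ 3`, all exponents): `negType_below_one_of_weakSep`, `rootMultiplicity_eq_one_of_weakSep` (such zeros are simple),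
`card_roots_window_add_sturm_eq_of_weakSep` (`#zeros in (a,b) + V(a) = V(b)`), `card_roots_below_eq_sturm_of_weakSep`, and
**`card_roots_unit_interval_eq_div_three_of_weakSep` / `card_posRoots_unit_interval_eq_div_three_of_weakSep`: if every zero of `D_m` in `(0,1)`
is weakly separated, the zeros in `(0,1)` number EXACTLY `⌊m/3⌋`, all simple**.  The hypothesis is automatic for `m ≤ 8` (p641687) and genuinely
needed from `m = 9` on (memo CROSSING-DIRECTION-liftp1g18.md §3: integer design with five zeros in `(0,1)`).
Nothing here is an upper law for the register (α NO MOVER); nothing bears on `WeakLifting` / `TropicalB` (stmt-19771) in their windows, Conjecture B,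
the Door-A registers, `MatrixDescartes` (stmt-18050) or VP ≠ VNP.
[this seat; folklore: Sturm sequences, definite-type eigenvalue crossings]
-/

-- `Summit.ValiantsHypothesis.ValiantsHypothesis.…` repeats a component by the D-0017 layout (single-conjunct summit); the name is mandated.
set_option linter.dupNamespace false
set_option autoImplicit false

namespace Summit.ValiantsHypothesis.ValiantsHypothesis.Theorems.KPlusLogSqLaw
namespace StaticTridiagonalRealUnit

open Real Finset Polynomial Matrix Filter Topology
open Summit.ValiantsHypothesis.ValiantsHypothesis.Theorems.KPlusLogSqLaw.StaticTridiagonalRealPotential (pathDet)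

variable (d : ℕ → ℕ) (f : ℕ → ℕ)

/-! ### 1. Negative type and simplicity at weakly separated zeros -/

/-- **NEGATIVE TYPE (all sizes, weak separation, degenerate zeros allowed)**. [this file] -/
theorem negType_below_one_of_weakSep (m : ℕ) (hm : 3 ≤ m) (t : ℝ) (ht : 0 < t) (ht1 : t < 1)
    (hslope : ∀ k, k + 1 < m → d k + d (k + 1) < 2 * f k)
    (hroot : (pathDet (fun _ => (1 : ℝ)) d (fun _ => (1 : ℝ)) f m).eval t = 0)
    (hsep : ∀ k, k + 4 < m →
      (pathDet (fun _ => (1 : ℝ)) d (fun _ => (1 : ℝ)) f k).eval t * (pathDet (fun _ => (1 : ℝ)) d (fun _ => (1 : ℝ)) f (k + 1)).eval t < 0 →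
      (pathDet (fun _ => (1 : ℝ)) d (fun _ => (1 : ℝ)) f (k + 3)).eval t * (pathDet (fun _ => (1 : ℝ)) d (fun _ => (1 : ℝ)) f (k + 4)).eval t < 0 →
      False)
    (u : Fin m → ℝ) (hu : (∑ κ, t ^ unitExponent d f m κ • unitLetter m κ) *ᵥ u = 0) (hu0 : u ≠ 0) :
    (derivative (∑ κ, C (u ⬝ᵥ (unitLetter m κ *ᵥ u)) * (X : ℝ[X]) ^ unitExponent d f m κ)).eval t < 0 := by
  have hE := slopeEnergy_pos_below_one_of_weakSep d f m hm t ht ht1 hslope hroot hsep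
  obtain ⟨n, rfl⟩ : ∃ n, m = n + 2 := ⟨m - 2, by omega⟩
  rw [show n + 2 - 1 = n + 1 from rfl] at hE
  exact negType_of_slopeEnergy_pos d f n t ht hroot hE u hu hu0

/-- **SIMPLICITY (all sizes, weak separation)**: `D′_m(t)·D_{m−1}(t) < 0`, so the zero is simple. [this file] -/
theorem rootMultiplicity_eq_one_of_weakSep (m : ℕ) (hm : 3 ≤ m) (t : ℝ) (ht : 0 < t) (ht1 : t < 1)
    (hslope : ∀ k, k + 1 < m → d k + d (k + 1) < 2 * f k)
    (hroot : (pathDet (fun _ => (1 : ℝ)) d (fun _ => (1 : ℝ)) f m).eval t = 0)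
    (hsep : ∀ k, k + 4 < m →
      (pathDet (fun _ => (1 : ℝ)) d (fun _ => (1 : ℝ)) f k).eval t * (pathDet (fun _ => (1 : ℝ)) d (fun _ => (1 : ℝ)) f (k + 1)).eval t < 0 →
      (pathDet (fun _ => (1 : ℝ)) d (fun _ => (1 : ℝ)) f (k + 3)).eval t * (pathDet (fun _ => (1 : ℝ)) d (fun _ => (1 : ℝ)) f (k + 4)).eval t < 0 →
      False) :
    (pathDet (fun _ => (1 : ℝ)) d (fun _ => (1 : ℝ)) f m).rootMultiplicity t = 1 := by
  have hE := slopeEnergy_pos_below_one_of_weakSep d f m hm t ht ht1 hslope hroot hsep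
  obtain ⟨n, rfl⟩ : ∃ n, m = n + 2 := ⟨m - 2, by omega⟩
  rw [show n + 2 - 1 = n + 1 from rfl] at hE
  have hder := deriv_mul_prev_neg_of_slopeEnergy_pos d f n t ht hroot hE
  have hP0 : pathDet (fun _ => (1 : ℝ)) d (fun _ => (1 : ℝ)) f (n + 2) ≠ 0 := by
    intro h0
    rw [h0, derivative_zero, eval_zero, zero_mul] at hder
    exact lt_irrefl _ hder
  have hpos : 0 < (pathDet (fun _ => (1 : ℝ)) d (fun _ => (1 : ℝ)) f (n + 2)).rootMultiplicity t :=
    (rootMultiplicity_pos hP0).2 hroot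
  have hle : ¬ 1 < (pathDet (fun _ => (1 : ℝ)) d (fun _ => (1 : ℝ)) f (n + 2)).rootMultiplicity t := by
    rw [one_lt_rootMultiplicity_iff_isRoot hP0]
    rintro ⟨-, h2⟩
    rw [IsRoot.def] at h2
    rw [h2, zero_mul] at hder
    exact lt_irrefl _ hder
  omega

/-! ### 2. The exact window count -/

/-- **EXACT WINDOW COUNT (all sizes, weak separation)**: all slopes positive, `0 < a < b < 1`, no `D_k` (`k ≤ m`) vanishing at `a` or `b`, every zero
of `D_m` in `(a,b)` weakly separated ⇒ `#zeros in (a,b) + V(a) = V(b)`. [this file] -/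
theorem card_roots_window_add_sturm_eq_of_weakSep (m : ℕ) (hm : 3 ≤ m) {a b : ℝ} (ha0 : 0 < a) (hab : a < b) (hb1 : b < 1)
    (hslope : ∀ k, k + 1 < m → d k + d (k + 1) < 2 * f k)
    (ha : ∀ k, k ≤ m → (pathDet (fun _ => (1 : ℝ)) d (fun _ => (1 : ℝ)) f k).eval a ≠ 0)
    (hb : ∀ k, k ≤ m → (pathDet (fun _ => (1 : ℝ)) d (fun _ => (1 : ℝ)) f k).eval b ≠ 0)
    (hsep : ∀ t, a < t → t < b → (pathDet (fun _ => (1 : ℝ)) d (fun _ => (1 : ℝ)) f m).eval t = 0 → ∀ k, k + 4 < m →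
      (pathDet (fun _ => (1 : ℝ)) d (fun _ => (1 : ℝ)) f k).eval t * (pathDet (fun _ => (1 : ℝ)) d (fun _ => (1 : ℝ)) f (k + 1)).eval t < 0 →
      (pathDet (fun _ => (1 : ℝ)) d (fun _ => (1 : ℝ)) f (k + 3)).eval t * (pathDet (fun _ => (1 : ℝ)) d (fun _ => (1 : ℝ)) f (k + 4)).eval t < 0 →
      False) :
    Multiset.card ((pathDet (fun _ => (1 : ℝ)) d (fun _ => (1 : ℝ)) f m).roots.filter (fun t => a < t ∧ t < b)) +
        (Finset.univ.filter fun k : Fin m =>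
          (pathDet (fun _ => (1 : ℝ)) d (fun _ => (1 : ℝ)) f k).eval a * (pathDet (fun _ => (1 : ℝ)) d (fun _ => (1 : ℝ)) f (k + 1)).eval a < 0).card =
      (Finset.univ.filter fun k : Fin m =>
          (pathDet (fun _ => (1 : ℝ)) d (fun _ => (1 : ℝ)) f k).eval b * (pathDet (fun _ => (1 : ℝ)) d (fun _ => (1 : ℝ)) f (k + 1)).eval b < 0).card := by
  classical
  have hS := unitLetter_isSymm m
  have hdet : ∀ x : ℝ, (∑ κ, x ^ unitExponent d f m κ • unitLetter m κ).det = (pathDet (fun _ => (1 : ℝ)) d (fun _ => (1 : ℝ)) f m).eval x := by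
    intro x
    rw [unitPencil_eq_ctPath, Summit.ValiantsHypothesis.ValiantsHypothesis.Theorems.KPlusLogSqLaw.SturmJacobi.det_evalPath]
  have hwin := Summit.ValiantsHypothesis.ValiantsHypothesis.Theorems.LacunarySymmetroidMatrixDescartes.Inertia.card_roots_Ioo_add_negIndex_eq_of_negType
    (unitExponent d f m) (unitLetter m) hS hab (by rw [hdet]; exact ha m le_rfl) (by rw [hdet]; exact hb m le_rfl)
    (fun t hat htb hdt u hu hu0 => negType_below_one_of_weakSep d f m hm t (ha0.trans hat) (htb.trans hb1) hslope
      (by rw [← hdet]; exact hdt) (hsep t hat htb (by rw [← hdet]; exact hdt)) u hu hu0)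
  obtain ⟨h1, -⟩ := hwin
  rw [det_unitPencil] at h1
  have hνa := Summit.ValiantsHypothesis.ValiantsHypothesis.Theorems.KPlusLogSqLaw.SturmJacobi.negIndex_eval_eq_sturmCount
    (fun _ => (1 : ℝ)) d (fun _ => (1 : ℝ)) f m (x := a) ha
  have hνb := Summit.ValiantsHypothesis.ValiantsHypothesis.Theorems.KPlusLogSqLaw.SturmJacobi.negIndex_eval_eq_sturmCount
    (fun _ => (1 : ℝ)) d (fun _ => (1 : ℝ)) f m (x := b) hb
  have ea : Fintype.card {j // (Summit.ValiantsHypothesis.ValiantsHypothesis.Theorems.LacunarySymmetroidMatrixDescartes.Inertia.isHermitian_pencil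
      (unitExponent d f m) (unitLetter m) hS a).eigenvalues j < 0} =
      (Finset.univ.filter fun k : Fin m =>
        (pathDet (fun _ => (1 : ℝ)) d (fun _ => (1 : ℝ)) f k).eval a * (pathDet (fun _ => (1 : ℝ)) d (fun _ => (1 : ℝ)) f (k + 1)).eval a < 0).card := by
    rw [negIndex_congr (unitPencil_eq_ctPath d f m a) _
      (Summit.ValiantsHypothesis.ValiantsHypothesis.Theorems.KPlusLogSqLaw.SturmJacobi.ctPathSymm_isHermitian _ _ m)]
    exact hνa
  have eb : Fintype.card {j // (Summit.ValiantsHypothesis.ValiantsHypothesis.Theorems.LacunarySymmetroidMatrixDescartes.Inertia.isHermitian_pencil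
      (unitExponent d f m) (unitLetter m) hS b).eigenvalues j < 0} =
      (Finset.univ.filter fun k : Fin m =>
        (pathDet (fun _ => (1 : ℝ)) d (fun _ => (1 : ℝ)) f k).eval b * (pathDet (fun _ => (1 : ℝ)) d (fun _ => (1 : ℝ)) f (k + 1)).eval b < 0).card := by
    rw [negIndex_congr (unitPencil_eq_ctPath d f m b) _
      (Summit.ValiantsHypothesis.ValiantsHypothesis.Theorems.KPlusLogSqLaw.SturmJacobi.ctPathSymm_isHermitian _ _ m)]
    exact hνb
  rw [ea, eb] at h1
  exact h1

/-- **ZEROS BELOW A SCALE = STURM COUNT (all sizes, weak separation)**. [this file] -/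
theorem card_roots_below_eq_sturm_of_weakSep (m : ℕ) (hm : 3 ≤ m) {b : ℝ} (hb0 : 0 < b) (hb1 : b < 1)
    (hslope : ∀ k, k + 1 < m → d k + d (k + 1) < 2 * f k)
    (hb : ∀ k, k ≤ m → (pathDet (fun _ => (1 : ℝ)) d (fun _ => (1 : ℝ)) f k).eval b ≠ 0)
    (hsep : ∀ t, 0 < t → t < b → (pathDet (fun _ => (1 : ℝ)) d (fun _ => (1 : ℝ)) f m).eval t = 0 → ∀ k, k + 4 < m →
      (pathDet (fun _ => (1 : ℝ)) d (fun _ => (1 : ℝ)) f k).eval t * (pathDet (fun _ => (1 : ℝ)) d (fun _ => (1 : ℝ)) f (k + 1)).eval t < 0 →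
      (pathDet (fun _ => (1 : ℝ)) d (fun _ => (1 : ℝ)) f (k + 3)).eval t * (pathDet (fun _ => (1 : ℝ)) d (fun _ => (1 : ℝ)) f (k + 4)).eval t < 0 →
      False) :
    Multiset.card ((pathDet (fun _ => (1 : ℝ)) d (fun _ => (1 : ℝ)) f m).roots.filter (fun t => 0 < t ∧ t < b)) =
      (Finset.univ.filter fun k : Fin m =>
          (pathDet (fun _ => (1 : ℝ)) d (fun _ => (1 : ℝ)) f k).eval b * (pathDet (fun _ => (1 : ℝ)) d (fun _ => (1 : ℝ)) f (k + 1)).eval b < 0).card := by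
  set a := b / 4 with ha_def
  have ha0 : 0 < a := by rw [ha_def]; positivity
  have ha4 : a ≤ 1 / 4 := by rw [ha_def]; linarith
  have hab : a < b := by rw [ha_def]; linarith
  have hposA : ∀ x, 0 < x → x ≤ a → ∀ k, k ≤ m → 0 < (pathDet (fun _ => (1 : ℝ)) d (fun _ => (1 : ℝ)) f k).eval x := by
    intro x hx hxa k hk
    rcases Nat.eq_zero_or_pos k with rfl | hk0
    · rw [(eval_unit_zero_one d f x).1]; exact one_pos
    · obtain ⟨k', rfl⟩ : ∃ k', k = k' + 1 := ⟨k - 1, by omega⟩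
      exact (continuant_pos_of_le_quarter d f m x hx (hxa.trans ha4) hslope k' (by omega)).1
  have hwin := card_roots_window_add_sturm_eq_of_weakSep d f m hm ha0 hab hb1 hslope (fun k hk => (hposA a ha0 le_rfl k hk).ne') hb
    (fun t hat htb => hsep t (ha0.trans hat) htb)
  have hVa : (Finset.univ.filter fun k : Fin m =>
      (pathDet (fun _ => (1 : ℝ)) d (fun _ => (1 : ℝ)) f k).eval a * (pathDet (fun _ => (1 : ℝ)) d (fun _ => (1 : ℝ)) f (k + 1)).eval a < 0).card = 0 := by
    rw [Finset.card_eq_zero, Finset.filter_eq_empty_iff]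
    intro k _
    exact not_lt.2 (mul_pos (hposA a ha0 le_rfl k (by omega)) (hposA a ha0 le_rfl (k + 1) (by omega))).le
  have hfilt : (pathDet (fun _ => (1 : ℝ)) d (fun _ => (1 : ℝ)) f m).roots.filter (fun t => 0 < t ∧ t < b) =
      (pathDet (fun _ => (1 : ℝ)) d (fun _ => (1 : ℝ)) f m).roots.filter (fun t => a < t ∧ t < b) := by
    refine Multiset.filter_congr fun t ht => ⟨fun h => ⟨?_, h.2⟩, fun h => ⟨ha0.trans h.1, h.2⟩⟩
    by_contra hle
    have hroot : (pathDet (fun _ => (1 : ℝ)) d (fun _ => (1 : ℝ)) f m).eval t = 0 := (mem_roots'.1 ht).2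
    exact (hposA t h.1 (not_lt.1 hle) m le_rfl).ne' hroot
  rw [hfilt, ← hwin, hVa, add_zero]

/-! ### 3. The recessive count law for all sizes -/

/-- **THE RECESSIVE COUNT LAW FOR ALL SIZES (weak separation, all exponents)**: all slopes positive and every zero of `D_m` (`m ≥ 3`) in `(0,1)`
weakly separated ⇒ the zeros of `D_m` in `(0,1)` counted with multiplicity number EXACTLY `⌊m/3⌋`. [this file] -/
theorem card_roots_unit_interval_eq_div_three_of_weakSep (m : ℕ) (hm : 3 ≤ m)
    (hslope : ∀ k, k + 1 < m → d k + d (k + 1) < 2 * f k)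
    (hsep : ∀ t, 0 < t → t < 1 → (pathDet (fun _ => (1 : ℝ)) d (fun _ => (1 : ℝ)) f m).eval t = 0 → ∀ k, k + 4 < m →
      (pathDet (fun _ => (1 : ℝ)) d (fun _ => (1 : ℝ)) f k).eval t * (pathDet (fun _ => (1 : ℝ)) d (fun _ => (1 : ℝ)) f (k + 1)).eval t < 0 →
      (pathDet (fun _ => (1 : ℝ)) d (fun _ => (1 : ℝ)) f (k + 3)).eval t * (pathDet (fun _ => (1 : ℝ)) d (fun _ => (1 : ℝ)) f (k + 4)).eval t < 0 →
      False) :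
    Multiset.card ((pathDet (fun _ => (1 : ℝ)) d (fun _ => (1 : ℝ)) f m).roots.filter (fun t => 0 < t ∧ t < 1)) = m / 3 := by
  have hev : ∀ᶠ x in 𝓝[<] (1 : ℝ), ∀ k ∈ range (m + 1),
      0 < (if k % 6 < 3 then (1 : ℝ) else -1) * (pathDet (fun _ => (1 : ℝ)) d (fun _ => (1 : ℝ)) f k).eval x :=
    (Finset.eventually_all (range (m + 1))).2 fun k hk =>
      eventually_signTable_near_one d f m hslope k (by rw [mem_range] at hk; omega)
  obtain ⟨δ, hδ, hnear⟩ := exists_delta_of_eventually hev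
  set b : ℝ := 1 - min δ 1 / 2 with hb_def
  have hmin : 0 < min δ 1 := lt_min hδ one_pos
  have hb0 : 0 < b := by rw [hb_def]; have := min_le_right δ 1; linarith
  have hb1 : b < 1 := by rw [hb_def]; linarith
  have hbδ : 1 - δ < b := by rw [hb_def]; have := min_le_left δ 1; linarith
  have hsignAt : ∀ x, b ≤ x → x < 1 → ∀ k, k ≤ m →
      0 < (if k % 6 < 3 then (1 : ℝ) else -1) * (pathDet (fun _ => (1 : ℝ)) d (fun _ => (1 : ℝ)) f k).eval x :=
    fun x hx1 hx2 k hk => hnear x (by linarith) hx2 k (by rw [mem_range]; omega)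
  obtain ⟨hV, hbne⟩ := sturmCount_of_signTable d f m b (hsignAt b le_rfl hb1)
  have hbelow := card_roots_below_eq_sturm_of_weakSep d f m hm hb0 hb1 hslope hbne (fun t ht htb => hsep t ht (htb.trans hb1))
  rw [hV] at hbelow
  rw [← hbelow]
  congr 1
  refine Multiset.filter_congr fun t ht => ⟨fun h => ⟨h.1, ?_⟩, fun h => ⟨h.1, h.2.trans hb1⟩⟩
  by_contra hge
  have hroot : (pathDet (fun _ => (1 : ℝ)) d (fun _ => (1 : ℝ)) f m).eval t = 0 := (mem_roots'.1 ht).2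
  have := hsignAt t (not_lt.1 hge) h.2 m le_rfl
  rw [hroot, mul_zero] at this
  exact lt_irrefl _ this

/-- **THE RECESSIVE COUNT LAW FOR ALL SIZES in the census currency**: under the same hypotheses the DISTINCT zeros of `D_m` in `(0,1)` number exactly
`⌊m/3⌋`, all simple. [this file] -/
theorem card_posRoots_unit_interval_eq_div_three_of_weakSep (m : ℕ) (hm : 3 ≤ m)
    (hslope : ∀ k, k + 1 < m → d k + d (k + 1) < 2 * f k)
    (hsep : ∀ t, 0 < t → t < 1 → (pathDet (fun _ => (1 : ℝ)) d (fun _ => (1 : ℝ)) f m).eval t = 0 → ∀ k, k + 4 < m →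
      (pathDet (fun _ => (1 : ℝ)) d (fun _ => (1 : ℝ)) f k).eval t * (pathDet (fun _ => (1 : ℝ)) d (fun _ => (1 : ℝ)) f (k + 1)).eval t < 0 →
      (pathDet (fun _ => (1 : ℝ)) d (fun _ => (1 : ℝ)) f (k + 3)).eval t * (pathDet (fun _ => (1 : ℝ)) d (fun _ => (1 : ℝ)) f (k + 4)).eval t < 0 →
      False) :
    (((pathDet (fun _ => (1 : ℝ)) d (fun _ => (1 : ℝ)) f m).roots.toFinset).filter (fun t => 0 < t ∧ t < 1)).card = m / 3 := by
  classical
  rw [← card_roots_unit_interval_eq_div_three_of_weakSep d f m hm hslope hsep, ← Multiset.toFinset_filter]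
  refine Multiset.toFinset_card_of_nodup ?_
  rw [Multiset.nodup_iff_count_le_one]
  intro t
  rw [Multiset.count_filter]
  split_ifs with h
  · rw [count_roots]
    by_cases hroot : (pathDet (fun _ => (1 : ℝ)) d (fun _ => (1 : ℝ)) f m).eval t = 0
    · exact (rootMultiplicity_eq_one_of_weakSep d f m hm t h.1 h.2 hslope hroot (hsep t h.1 h.2 hroot)).le
    · rw [rootMultiplicity_eq_zero hroot]; exact Nat.zero_le _
  · exact Nat.zero_le _

end StaticTridiagonalRealUnit
end Summit.ValiantsHypothesis.ValiantsHypothesis.Theorems.KPlusLogSqLaw
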